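import Mathlib.MeasureTheory.Group.Action
import Mathlib.MeasureTheory.Measure.Regular
import Literature.NumberTheory.Automorphic.ParabolicGL
import Literature.NumberTheory.GaloisRepresentations.LocalField
import HarnessLib

/-!
# Named fact: the invariant measure on `GL_m(F) ⧸ U_m(F)` (Weil's criterion for quotient measures;
Loomis 1953, §33D)

Let `G` be a locally compact group, `H` a closed subgroup, `Δ`, `δ` their modular functions.
Loomis, *An Introduction to Abstract Harmonic Analysis* (1953), §33D, Theorem (with §33B–§33C):
a positive `G`-relatively-invariant Radon integral on `G ⧸ H` with modulus `D` exists if and only if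
`D(s) = Δ(s) / δ(s)` on `H`; for `D ≡ 1` this is Weil's criterion for an INVARIANT quotient measure,
and the measure is `K(F) = ∫_G f` for `F(xH) = ∫_H f(xh) dh` (§33B: `f ↦ F` maps `L⁺(G)` onto
`L⁺(G ⧸ H)`), positive on non-empty open sets and finite on compacta.

Here `G = GL_m(F)` over a non-archimedean local field `F` and `H = U_m(F)` (upper unitriangular,
`upperUnitriangular`).  Both modular functions are trivial on `U`: `U = ⋃_k t^k U(𝒪_F) t^{-k}`
(`t = diag(ϖ^{m-1}, …, ϖ, 1)`) is an increasing union of compact open subgroups, and a continuous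
homomorphism from a compact group to `ℝ_{>0}^×` is trivial.  So `GL_m(F) ⧸ U_m(F)` carries a
`GL_m(F)`-invariant Radon measure, positive on non-empty open sets.

## Tree form

`exists_smulInvariantMeasure_glQuotUpperUnitriangular F`: for every `m` and for the (Borel)
measurable structure on the quotient supplied by the consumer, there is a measure `ν` on
`GL (Fin m) F ⧸ upperUnitriangular (Fin m) F` with `SMulInvariantMeasure (GL (Fin m) F) _ ν`,
`IsFiniteMeasureOnCompacts ν`, `ν.IsOpenPosMeasure` — literally the measure hypotheses of the
Rankin–Selberg predicates `HasRSLFactor` / `HasRSEpsilon` and of `IsLocalLanglandsGL.lFactor_pairs`.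
The case `m = 1` is PROVED in the tree (`exists_haar_measure_quotient_fin_one`, transport of a Haar
measure of `Fˣ` along `Fˣ ≃ₜ GL₁(F) ⧸ U₁`); `m ≥ 2` had never been instantiated.

## Mathlib search

Mathlib has Haar measures (`MeasureTheory.Measure.haarMeasure`), `SMulInvariantMeasure`,
`IsFiniteMeasureOnCompacts`, `IsOpenPosMeasure`, and quotient measures for subgroups with a
fundamental domain / normal subgroups (`Mathlib.MeasureTheory.Measure.Haar.Quotient`:
`QuotientMeasureEqMeasurePreimage.smulInvariantMeasure_quotient`, which needs a measurable fundamental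
domain and a bi-invariant measure), but neither Weil's criterion for a general closed subgroup nor
measurable sections of `G → G ⧸ H` (`rg -i 'modular function' Mathlib/MeasureTheory`,
`rg "G ⧸" Mathlib/MeasureTheory/Measure/Haar`).  Nothing is re-declared.

## Deliberately NOT here

-- TODO(general form): Weil's criterion `Δ|_H = δ ↔ ∃` invariant Radon measure on `G ⧸ H` for an
arbitrary closed subgroup of a locally compact group, uniqueness up to a scalar, and Weil's formula
`∫_G f = ∫_{G/H} ∫_H f(xh)`; the discharge `…_holds`.
-/

noncomputable section

open scoped MatrixGroups
open _root_.MeasureTheory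

namespace Literature.NumberTheory.Automorphic

/-- **Invariant measure on `GL_m(F) ⧸ U_m(F)`** (named fact, D-0014).  Let `F` be a non-archimedean
local field, `G = GL_m(F)` and `U = U_m(F)` its closed subgroup of upper unitriangular matrices
(`upperUnitriangular`).  Then the homogeneous space `G ⧸ U` (quotient topology) carries a
`G`-invariant Borel measure, finite on compact sets and positive on non-empty open sets: Weil's
criterion for quotient measures (Loomis 1953, §33D, Theorem, with modulus `D ≡ 1`, and §33B–§33C for
the construction `K(F) = ∫_G f`, `F(xH) = ∫_H f(xh) dh`, a positive Radon integral) applies because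
both modular functions are trivial on `U = ⋃_k t^k U(𝒪_F) t^{-k}`, a union of compact subgroups.
Stated for the measurable structure supplied by the consumer (the Borel one), in the shape of the
measure hypotheses of `HasRSLFactor` / `IsLocalLanglandsGL.lFactor_pairs`; `m = 1` is the proved
`exists_haar_measure_quotient_fin_one`.
[cite: Loomis1953, §33D Theorem and §33B] -/
def exists_smulInvariantMeasure_glQuotUpperUnitriangular (F : Type*) [Field F] [ValuativeRel F]
    [TopologicalSpace F] [IsNonarchimedeanLocalField F] : Prop :=
  ∀ (m : ℕ) [MeasurableSpace (GL (Fin m) F ⧸ upperUnitriangular (Fin m) F)]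
    [BorelSpace (GL (Fin m) F ⧸ upperUnitriangular (Fin m) F)],
    ∃ ν : Measure (GL (Fin m) F ⧸ upperUnitriangular (Fin m) F),
      SMulInvariantMeasure (GL (Fin m) F) (GL (Fin m) F ⧸ upperUnitriangular (Fin m) F) ν ∧
      IsFiniteMeasureOnCompacts ν ∧ ν.IsOpenPosMeasure

end Literature.NumberTheory.Automorphic

end
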